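import Mathlib
import HarnessLib
import Summits.ValiantsHypothesis.ValiantsHypothesis.Theses.MonotoneRestoration
import Literature.Computability.AlgebraicComplexity.ArithCircuit
import Literature.Computability.AlgebraicComplexity.ArithCircuitProofs
import Literature.Computability.AlgebraicComplexity.MonotoneStructure
import Literature.Computability.AlgebraicComplexity.PermanentIrreducible
import Literature.ModelTheory.FiniteModelTheory.CkEquiv
import Summits.ValiantsHypothesis.ValiantsHypothesis.Theorems.MonotoneRestorationMonotoneRestorationQPCosetCount
import Summits.ValiantsHypothesis.ValiantsHypothesis.Theorems.MonotoneRestorationMonotoneRestorationQPSymmetricLB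
import Summits.ValiantsHypothesis.ValiantsHypothesis.Theorems.MonotoneRestorationMonotoneRestorationQPSupportSymmetrisation
import Summits.ValiantsHypothesis.ValiantsHypothesis.Theorems.MonotoneRestorationMonotoneRestorationQPSparseRegime
import Summits.ValiantsHypothesis.ValiantsHypothesis.Theorems.MonotoneRestorationMonotoneRestorationQPBeta
import Literature.Computability.AlgebraicComplexity.SymmetricArithCircuit
import Literature.Computability.AlgebraicComplexity.DawarWilsenach2025Proofs
import Literature.GroupTheory.PermutationGroups.SmallIndexSubgroups
import Summits.ValiantsHypothesis.ValiantsHypothesis.Theorems.MonotoneRestorationQP.Negative.LoadBearing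
import Summits.ValiantsHypothesis.ValiantsHypothesis.Theorems.MonotoneRestorationMonotoneRestorationQPPermSupportCount

/-! TTRL-lite variant V19871 of stmt-ValiantsHypothesis-15886 -/

-- `ValiantsHypothesis.ValiantsHypothesis`: the D-0017 layout repeats the problem name in the path.
set_option linter.dupNamespace false

namespace Summit.ValiantsHypothesis.ValiantsHypothesis.Theorems

open Summit.ValiantsHypothesis.ValiantsHypothesis.Theses.MonotoneRestoration
open Literature.Computability.AlgebraicComplexity

/-- TTRL-lite variant V19871 (move `generalise`) of `stub_mulGate_children_extend` is FALSE:
membership of the support of a product `p * q` in an UPPER set `S` of monomials does not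
descend to the support of the factor `p`. Witness (`n := 1`, coefficients in `ℝ≥0`):
`p = q = X (0,0)` and `S = {m | 2 ≤ m (0,0)}`; then `supp (p * q) = {single (0,0) 2} ⊆ S`
while `supp p = {single (0,0) 1} ⊄ S`. (Descent through products only transports
divisor-closed, i.e. lower-set, properties.) [folklore] -/
theorem stub_mulGate_children_extend_var19871_false :
    ¬ (∀ (p q : MvPolynomial (Fin 1 × Fin 1) NNReal) (S : Set ((Fin 1 × Fin 1) →₀ ℕ)),
        (∀ a b : (Fin 1 × Fin 1) →₀ ℕ, a ≤ b → a ∈ S → b ∈ S) → p * q ≠ 0 →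
        (∀ m ∈ (p * q).support, m ∈ S) → ∀ m ∈ p.support, m ∈ S) := by
  intro h
  have hXX : (MvPolynomial.X ((0 : Fin 1), (0 : Fin 1)) : MvPolynomial (Fin 1 × Fin 1) NNReal) *
      MvPolynomial.X ((0 : Fin 1), (0 : Fin 1)) =
      MvPolynomial.monomial (Finsupp.single ((0 : Fin 1), (0 : Fin 1)) 2) 1 := by
    rw [← pow_two, MvPolynomial.X_pow_eq_monomial]
  have key := h (MvPolynomial.X (0, 0)) (MvPolynomial.X (0, 0)) {m | 2 ≤ m (0, 0)} ?_ ?_ ?_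
    (Finsupp.single (0, 0) 1) ?_
  · simp only [Set.mem_setOf_eq, Finsupp.single_eq_same] at key
    omega
  · intro a b hab ha
    simp only [Set.mem_setOf_eq] at ha ⊢
    exact le_trans ha (hab (0, 0))
  · rw [hXX]
    exact (MvPolynomial.monomial_eq_zero).not.mpr one_ne_zero
  · intro m hm
    classical
    rw [hXX, MvPolynomial.support_monomial, if_neg one_ne_zero, Finset.mem_singleton] at hm
    subst hm
    simp only [Set.mem_setOf_eq, Finsupp.single_eq_same, le_refl]
  · rw [MvPolynomial.support_X, Finset.mem_singleton]

end Summit.ValiantsHypothesis.ValiantsHypothesis.Theorems
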